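import Summits.NavierStokesRegularity.NavierStokesRegularity.Theorems.ScenarioCensusPatternMeter
import Summits.NavierStokesRegularity.NavierStokesRegularity.Theorems.ScenarioCensusRotationOrder
import Summits.NavierStokesRegularity.NavierStokesRegularity.Theorems.ScenarioCensusGeneratorMeter
import Summits.NavierStokesRegularity.NavierStokesRegularity.Theorems.ScenarioCensusInertialMeter
import HarnessLib

/-!
# PATTERN METER port, part 2/3: §N normal form with drift and the screw integration lemma; §L ONE-SLICE KILLING LIOUVILLE; (§R, the line's verbatim reproduction of LINE «inertial-meter», is
# the landed INERTIAL METER port BY NAME); §V VORTEX-LINE PATTERNS (a Killing generator annihilating the VORTICITY of one slice kills)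

Re-homed for the scenario census (typer seat ns-census-typer-1 g10; the cells A2ptK / A2ptT / A2pwK / A2pwT / A2gkK / A2gkW are members of row A2 «DECIDED IN KERNEL IN FILES» (ns-idea-2
g18 LINE g18-2; ref ns-census-ref g15 PRE-CHECK ✓ §20.20; critic / lead booking per the census), A2ptP / A2ptS OPEN (typed); this port makes the decided cells TREE-decided): VERBATIM
PORT of ns-idea-2 LINE g18-2 «pattern-meter», `pub/ideators/ns-idea-2/lines/pattern-meter/line-pattern-meter.lean` sha16 5ea38914a8b301c3 (1044 l., lean check rc 0, 0 sorry), split for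
the 400-line rule into `ScenarioCensusPatternMeter` (§0, §A, §K) → `…PatternMeterKilling` (§N, §L, §V) → `…PatternMeterRows` (§C, §G + census KEYS).  Lean text VERBATIM in namespace
`…Theorems.ScenarioCensus.PatternMeter` (the line's `…Lines.PatternMeter` re-homed); port edits: the line's `local notation "E3"` is spelled as the reducible `abbrev E3` of every
census file; §R (the line's VERBATIM reproduction of LINE «inertial-meter», namespace `Reproduced`) is NOT re-declared — the landed INERTIAL METER port is used BY NAME
(`InertialMeter.contDiff_two_slice` / `vorticityPocketRigidity` / `eq_zero_of_vorticityPeriodic_pocket`); elementary lemmas the line restates are the tree's BY NAME (gate lint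
dedup.landed): `rotZ_two_pi` = `SymmetricLiouville.Negative.rotZ_two_pi` (ScrewClause), `rotZ_rotZ_neg` / `rotZ_neg_rotZ` = `RotationOrder.…`,
`analyticAt_clm_apply` = `GeneratorMeter.…`; `rotGenL_ne_zero` (twin of a lemma in a module outside this closure) is not re-declared, its proof is inlined at the use sites; `@[conjecture]` on the OPEN rows `Row_A2ptP`, `Row_A2ptS`; one-line docstrings added where missing (gate lint).  Statements untouched.

No census VALUE is moved here (row A2 stays OPEN-WITH-LINE; the members become TREE-decided by name); (L′) is NOT proved; no summit statement is proved by this file. Lemmas that restate already-landed tree declarations are taken BY NAME (gate lint `dedup.landed`): `rotZ_two_pi` = `SymmetricLiouville.Negative.rotZ_two_pi`, `rotZ_rotZ_neg` = `RotationOrder.rotZ_rotZ_neg`, `rotZ_neg_rotZ` = `RotationOrder.rotZ_neg_rotZ`, `analyticAt_clm_apply` = `GeneratorMeter.analyticAt_clm_apply`.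
-/

-- the summit and its single problem share the name `NavierStokesRegularity` (D-0017 nested layout)
set_option linter.dupNamespace false

noncomputable section

open Set Function Filter Metric MeasureTheory InnerProductSpace
open scoped Topology RealInnerProductSpace
open Literature.Analysis Literature.Analysis.FluidPDE
open Summit.NavierStokesRegularity.NavierStokesRegularity.Theorems
open Summit.NavierStokesRegularity.NavierStokesRegularity.Theorems.ScenarioCensus
open Summit.NavierStokesRegularity.NavierStokesRegularity.Theorems.AxisymEndLiouville.AbsorbingAxisSwirlExtinction

namespace Summit.NavierStokesRegularity.NavierStokesRegularity.Theorems.ScenarioCensus.PatternMeter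

variable {C C' : ℝ} {u v : ℝ → E3 → E3}

/-! ## N. Normal form with drift and the screw integration lemma -/

/-- **Symmetry transport with drift.**  If `Dφ(x)[a + A(x − c)] = A φ(x)` on `ℝ³` and `L A L⁻¹ = α J`
(`α ≠ 0`), then, with `c₁ = c + L⁻¹(α⁻¹ J (L a))` and pitch `p = α⁻¹ (L a)₃`, the normalised field
`ψ(z) = L φ(L⁻¹ z + c₁)` has the infinitesimal SCREW symmetry `Dψ(y)[J y + p e₃] = J ψ(y)`. -/
theorem fderiv_normalised_screw {φ : E3 → E3} (hφ : Differentiable ℝ φ) (L : E3 ≃ₗᵢ[ℝ] E3)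
    {A : E3 →L[ℝ] E3} {α : ℝ} (hα : α ≠ 0) (hconj : ∀ y, L (A (L.symm y)) = α • rotGen y)
    (a c : E3) (hsym : ∀ x, fderiv ℝ φ x (a + A (x - c)) = A (φ x)) (y : E3) :
    fderiv ℝ (fun z => L (φ (L.symm z + (c + L.symm (α⁻¹ • rotGen (L a)))))) y
        (rotGen y + (α⁻¹ * (L a) 2) • e₃) =
      rotGen (L (φ (L.symm y + (c + L.symm (α⁻¹ • rotGen (L a)))))) := by
  set c₁ := c + L.symm (α⁻¹ • rotGen (L a)) with hc₁
  set x := L.symm y + c₁ with hx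
  have e2 : L (A (L.symm (α⁻¹ • rotGen (L a)))) = rotGen (rotGen (L a)) := by
    rw [L.symm.map_smul, map_smul, L.map_smul, hconj, smul_smul, inv_mul_cancel₀ hα, one_smul]
  have hdir : L (a + A (x - c)) = α • rotGen y + (L a) 2 • e₃ := by
    have e1 : x - c = L.symm y + L.symm (α⁻¹ • rotGen (L a)) := by rw [hx, hc₁]; abel
    rw [e1, map_add A, map_add L, map_add L, hconj y, e2, ← self_add_rotGen_rotGen (L a)]
    abel
  have e3 : L.symm (rotGen y + (α⁻¹ * (L a) 2) • e₃) = α⁻¹ • (a + A (x - c)) := by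
    apply L.injective
    rw [L.apply_symm_apply, L.map_smul, hdir, smul_add, smul_smul, inv_mul_cancel₀ hα, one_smul,
      smul_smul]
  rw [fderiv_conj_apply L hφ c₁ y, e3, map_smul, ← hx, hsym x, L.map_smul]
  have e4 := hconj (L (φ x))
  rw [L.symm_apply_apply] at e4
  rw [e4, smul_smul, inv_mul_cancel₀ hα, one_smul]

/-- **Screw integration lemma — the tree's, BY NAME.**  A differentiable field with `Df(y)[J y + p e₃] = J f(y)`
everywhere is equivariant under the screw motions `y ↦ R_θ y + pθ e₃`: `f(R_θ y + pθ e₃) = R_θ f(y)`.  This is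
`…Theorems.SymmetricLiouville.Negative.screw_equivariant` (crux ⟨stmt-4053⟩, negative side, `ScrewClause.lean`:
«the screw clause integrates»; its `ez` and this file's `e₃` are both `EuclideanSpace.single 2 1`), restated in
this file's letters; the case `p = 0` is the tree's `isAxisymmetric_of_fderiv_rotGen`. -/
theorem screw_of_fderiv {f : E3 → E3} (hf : Differentiable ℝ f) (p : ℝ)
    (h : ∀ y, fderiv ℝ f y (rotGen y + p • e₃) = rotGen (f y)) :
    ∀ θ y, f (rotZ θ y + (p * θ) • e₃) = rotZ θ (f y) := by
  intro θ y
  have hcl : ∀ z, fderiv ℝ f z (p • Theorems.SymmetricLiouville.Negative.ez + rotGen z) = rotGen (f z) :=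
    fun z => by rw [add_comm]; exact h z
  have key := Theorems.SymmetricLiouville.Negative.screw_equivariant hf p hcl θ y
  rw [mul_comm θ p] at key
  exact key

/-! ## L. ONE-SLICE KILLING LIOUVILLE: a Killing generator annihilating ONE slice kills the element -/

/-- Back-transfer: if the normalised class element `v(t,y) = L u(t, L⁻¹y + c₁)` vanishes then so does `u`. -/
theorem eq_zero_of_conj_eq_zero (L : E3 ≃ₗᵢ[ℝ] E3) (c₁ : E3) {t : ℝ}
    (h : ∀ y, L (u t (L.symm y + c₁)) = 0) (x : E3) : u t x = 0 := by
  have := h (L (x - c₁))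
  rw [L.symm_apply_apply, sub_add_cancel] at this
  simpa using congrArg L.symm this

/-- **One-slice Killing Liouville.**  Let `u ∈ A_C` and suppose ONE slice `u(t₀,·)`, `t₀ < 0`, commutes on
`ℝ³` with a nonzero Killing field `k = a + A(· − c)` (`A` skew; `A ≠ 0` or `a ≠ 0`):
`Du(t₀,x)[k x] = A u(t₀,x)`.  Then `u ≡ 0` on `t < 0`.
TRANSLATION (`A = 0`): the slice is `a`-periodic ⇒ (germ rigidity) every slice is ⇒ Type-I periodic Liouville.
ROTATION (`A ≠ 0`, zero pitch): the normalised slice is axisymmetric (screw lemma, `p = 0`) ⇒ (isometry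
germ rigidity, angle by angle) every slice is ⇒ infinitesimal symmetry on the whole end ⇒ the CLOSED rung
`AxisymEndLiouville` ⟨stmt-14061⟩ BY NAME (`AxisymEndLiouville_of`).
SCREW (`A ≠ 0`, pitch `p ≠ 0`): the normalised slice is screw-equivariant, θ = 2π makes it `2πp e₃`-PERIODIC
⇒ every slice is ⇒ Type-I periodic Liouville.  (The helical case is thus decided WITHOUT any helical
Liouville theorem: a helix closes up to a translation.) -/
theorem liouville_of_sliceKilling (hu : IsTypeIAncientMild C u) {t₀ : ℝ} (ht₀ : t₀ < 0)
    {A : E3 →L[ℝ] E3} (hskew : ∀ x, ⟪A x, x⟫ = 0) (a c : E3) (hnd : A ≠ 0 ∨ a ≠ 0)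
    (hsym : ∀ x, fderiv ℝ (u t₀) x (a + A (x - c)) = A (u t₀ x)) :
    ∀ t < 0, ∀ x, u t x = 0 := by
  have hφ : Differentiable ℝ (u t₀) := (hu.contDiff_slice ht₀).differentiable (by simp)
  by_cases hA : A = 0
  · -- TRANSLATION
    have ha : a ≠ 0 := by
      rcases hnd with h | h
      · exact absurd hA h
      · exact h
    subst hA
    have hsym' : ∀ x, fderiv ℝ (u t₀) x a = 0 := fun x => by simpa using hsym x
    have hper₀ : ∀ x, u t₀ (x + a) = u t₀ x := periodic_of_fderiv_eq_zero hφ a hsym'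
    have hper : ∀ t < 0, ∀ x, u t (x + a) = u t x := fun t ht x =>
      translationInvariant_of_germ hu ht₀ isOpen_univ univ_nonempty a (fun x _ => hper₀ x) ht x
    exact PeriodicGauge.periodic_typeI_liouville_genuine C u hu a ha hper
  · obtain ⟨L, α, hα, hconj⟩ := exists_conj_eq_smul_rotGen hskew hA
    set c₁ := c + L.symm (α⁻¹ • rotGen (L a)) with hc₁
    set p := α⁻¹ * (L a) 2 with hp_def
    set v : ℝ → E3 → E3 := fun t y => L (u t (L.symm y + c₁)) with hv_def
    have hv : IsTypeIAncientMild C v :=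
      SymmetryModuliCountSymmetricLiouville.isTypeIAncientMild_conj_linearIsometryEquiv
        (isTypeIAncientMild_comp_add hu c₁) L
    have hvd : Differentiable ℝ (v t₀) := (hv.contDiff_slice ht₀).differentiable (by simp)
    have hinf : ∀ y, fderiv ℝ (v t₀) y (rotGen y + p • e₃) = rotGen (v t₀ y) := fun y =>
      fderiv_normalised_screw hφ L hα hconj a c hsym y
    have hscrew : ∀ θ y, v t₀ (rotZ θ y + (p * θ) • e₃) = rotZ θ (v t₀ y) :=
      screw_of_fderiv hvd p hinf
    suffices hzero : ∀ t < 0, ∀ y, v t y = 0 from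
      fun t ht x => eq_zero_of_conj_eq_zero L c₁ (hzero t ht) x
    by_cases hp : p = 0
    · -- ROTATION: axisymmetric slice ⇒ axisymmetric end ⇒ `AxisymEndLiouville_of`
      have haxi₀ : ∀ θ y, v t₀ (rotZ θ y) = rotZ θ (v t₀ y) := fun θ y => by
        simpa [hp] using hscrew θ y
      have haxi : ∀ t < 0, IsAxisymmetric (v t) := by
        intro t ht θ y
        have hinv := isometryInvariant_of_germ hv (rotZLIE θ) ht₀ isOpen_univ univ_nonempty
          (fun x _ => by
            rw [rotZLIE_apply, rotZLIE_symm_apply, ← haxi₀ θ, RotationOrder.rotZ_rotZ_neg]) ht (rotZ θ y)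
        rw [rotZLIE_apply, rotZLIE_symm_apply, RotationOrder.rotZ_neg_rotZ] at hinv
        exact hinv.symm
      have hsymAll : ∀ t < (0 : ℝ), ∀ y, fderiv ℝ (v t) y (rotGenL (y - 0)) - rotGenL (v t y) = 0 := by
        intro t ht y
        rw [sub_zero, rotGenL_apply, rotGenL_apply,
          (haxi t ht).fderiv_rotGen (((hv.contDiff_slice ht).differentiable (by simp)) y), sub_self]
      exact AxisymEndLiouville_of C v hv 0 rotGenL 0
        (fun x => by rw [rotGenL_apply]; exact inner_rotGen_self x) (by intro h; simpa [rotGenL_apply, rotGen] using congrArg (fun T : E3 →L[ℝ] E3 => T (EuclideanSpace.single 0 1) 1) h)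
        le_rfl hsymAll
    · -- SCREW: `θ = 2π` closes the helix up to the translation `2πp e₃`
      have hP : (p * (2 * Real.pi)) • (e₃ : E3) ≠ 0 :=
        smul_ne_zero (mul_ne_zero hp (by positivity)) (by intro h; simpa [e₃] using congrArg (fun v : E3 => v 2) h)
      have hper₀ : ∀ y, v t₀ (y + (p * (2 * Real.pi)) • e₃) = v t₀ y := fun y => by
        have := hscrew (2 * Real.pi) y
        rwa [SymmetricLiouville.Negative.rotZ_two_pi, SymmetricLiouville.Negative.rotZ_two_pi] at this
      have hper : ∀ t < 0, ∀ y, v t (y + (p * (2 * Real.pi)) • e₃) = v t y := fun t ht y =>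
        translationInvariant_of_germ hv ht₀ isOpen_univ univ_nonempty _ (fun y _ => hper₀ y) ht y
      exact PeriodicGauge.periodic_typeI_liouville_genuine C v hv _ hP hper

/-- **Streamline pattern Liouville.**  If the STREAMLINES of ONE slice of `u ∈ A_C` are, on a pocket, orbits
of a nonzero Killing field — `u(t₀,x) ∥ a + A(x − c)` on a nonempty open `U` (free amplitude) — then
`u ≡ 0`.  (`lie_eq_of_pattern` + `liouville_of_sliceKilling`.) -/
theorem liouville_of_streamlinePattern (hu : IsTypeIAncientMild C u) {t₀ : ℝ} (ht₀ : t₀ < 0)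
    {A : E3 →L[ℝ] E3} (hskew : ∀ x, ⟪A x, x⟫ = 0) (a c : E3) (hnd : A ≠ 0 ∨ a ≠ 0)
    {U : Set E3} (hU : IsOpen U) (hne : U.Nonempty) {f : E3 → ℝ}
    (hpat : ∀ x ∈ U, u t₀ x = f x • (a + A (x - c))) : ∀ t < 0, ∀ x, u t x = 0 :=
  liouville_of_sliceKilling hu ht₀ hskew a c hnd
    (lie_eq_of_pattern (hu.analyticOnNhd_slice_univ ht₀) (hu.isDivFree ht₀) hskew a c hU hne hpat)

/-! ## V. VORTEX-LINE PATTERNS: a Killing generator annihilating the VORTICITY of ONE slice kills -/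

/-- `curl` of the conjugate of a field by a rotation about the vertical axis (tree `curlCLM_rotZL_conj`;
rotations are proper, no sign). -/
theorem curl_conj_rotZ {φ : E3 → E3} (hφ : Differentiable ℝ φ) (θ : ℝ) (y : E3) :
    curl (fun z => rotZ θ (φ (rotZ (-θ) z))) y = rotZ θ (curl φ (rotZ (-θ) y)) := by
  have h1 : HasFDerivAt (fun z : E3 => rotZ (-θ) z) (rotZL (-θ)) y := (rotZL (-θ)).hasFDerivAt
  have h2 : HasFDerivAt (fun z => φ (rotZ (-θ) z)) ((fderiv ℝ φ (rotZ (-θ) y)).comp (rotZL (-θ))) y :=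
    (hφ _).hasFDerivAt.comp y h1
  have h3 : HasFDerivAt (fun z => rotZ θ (φ (rotZ (-θ) z)))
      ((rotZL θ).comp ((fderiv ℝ φ (rotZ (-θ) y)).comp (rotZL (-θ)))) y :=
    (rotZL θ).hasFDerivAt.comp y h2
  rw [curl_eq_curlCLM, curl_eq_curlCLM, h3.fderiv, curlCLM_rotZL_conj]

/-- The rotation generator is linear over scalars. -/
theorem rotGen_smul (r : ℝ) (w : E3) : rotGen (r • w) = r • rotGen w := by
  rw [← rotGenL_apply, map_smul, rotGenL_apply]

/-- Slices have differentiable vorticity. -/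
theorem differentiable_curl_slice (hu : IsTypeIAncientMild C u) {t : ℝ} (ht : t < 0) :
    Differentiable ℝ (curl (u t)) :=
  differentiableOn_univ.1 (analyticOnNhd_curl (hu.analyticOnNhd_slice_univ ht)).differentiableOn

/-- An axisymmetric VORTICITY slice makes the element axisymmetric at all times (vorticity-pocket rigidity
against the rotated copies `R_θ v R_{−θ} ∈ A_C`, angle by angle). -/
theorem isAxisymmetric_of_curl_slice (hv : IsTypeIAncientMild C v) {t₀ : ℝ} (ht₀ : t₀ < 0)
    (haxiω : ∀ θ y, curl (v t₀) (rotZ θ y) = rotZ θ (curl (v t₀) y)) : ∀ t < 0, IsAxisymmetric (v t) := by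
  intro t ht θ y
  have hw : IsTypeIAncientMild C (fun t z => rotZLIE θ (v t ((rotZLIE θ).symm z))) :=
    SymmetryModuliCountSymmetricLiouville.isTypeIAncientMild_conj_linearIsometryEquiv hv (rotZLIE θ)
  have hvd : Differentiable ℝ (v t₀) := (hv.contDiff_slice ht₀).differentiable (by simp)
  have hcurlw : ∀ z ∈ (univ : Set E3),
      curl (fun z => rotZLIE θ (v t₀ ((rotZLIE θ).symm z))) z = curl (v t₀) z := by
    intro z _
    show curl (fun z => rotZ θ (v t₀ (rotZ (-θ) z))) z = curl (v t₀) z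
    rw [curl_conj_rotZ hvd θ z, ← haxiω θ, RotationOrder.rotZ_rotZ_neg]
  have hrig := InertialMeter.vorticityPocketRigidity hw hv ht₀ isOpen_univ univ_nonempty hcurlw ht (rotZ θ y)
  have e : rotZLIE θ (v t ((rotZLIE θ).symm (rotZ θ y))) = rotZ θ (v t y) := by
    rw [rotZLIE_apply, rotZLIE_symm_apply, RotationOrder.rotZ_neg_rotZ]
  rw [← e]
  exact hrig.symm

/-- An element of `A_C` axisymmetric (integrated sense) at ALL times `t < 0` vanishes: the CLOSED rung
`AxisymEndLiouville` ⟨stmt-14061⟩ BY NAME (`AxisymEndLiouville_of`), fed with the infinitesimal symmetry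
`IsAxisymmetric.fderiv_rotGen`. -/
theorem eq_zero_of_isAxisymmetric_all (hv : IsTypeIAncientMild C v) (haxi : ∀ t < 0, IsAxisymmetric (v t)) :
    ∀ t < 0, ∀ y, v t y = 0 := by
  have hsymAll : ∀ t < (0 : ℝ), ∀ y, fderiv ℝ (v t) y (rotGenL (y - 0)) - rotGenL (v t y) = 0 := by
    intro t ht y
    rw [sub_zero, rotGenL_apply, rotGenL_apply,
      (haxi t ht).fderiv_rotGen (((hv.contDiff_slice ht).differentiable (by simp)) y), sub_self]
  exact AxisymEndLiouville_of C v hv 0 rotGenL 0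
    (fun x => by rw [rotGenL_apply]; exact inner_rotGen_self x) (by intro h; simpa [rotGenL_apply, rotGen] using congrArg (fun T : E3 →L[ℝ] E3 => T (EuclideanSpace.single 0 1) 1) h)
        le_rfl hsymAll

/-- **Vorticity one-slice Killing Liouville.**  Let `u ∈ A_C` and suppose the VORTICITY of ONE slice,
`ω = curl u(t₀,·)`, commutes on `ℝ³` with a nonzero Killing field: `Dω(x)[a + A(x − c)] = A ω(x)`.  Then
`u ≡ 0`.  TRANSLATION: `ω` is `a`-periodic ⇒ (reproduced) periodic-vorticity cell.  ROTATION: the normalised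
vorticity slice is axisymmetric ⇒ (`isAxisymmetric_of_curl_slice`) the normalised element is axisymmetric
at all times ⇒ `AxisymEndLiouville_of`.  SCREW: the normalised vorticity slice is `2πp e₃`-periodic ⇒
periodic-vorticity cell.  (Vorticity is a pseudovector: the normalising isometry may be improper, which
only multiplies the normalised vorticity by `det L = ±1` and is harmless.) -/
theorem liouville_of_vorticitySliceKilling (hu : IsTypeIAncientMild C u) {t₀ : ℝ} (ht₀ : t₀ < 0)
    {A : E3 →L[ℝ] E3} (hskew : ∀ x, ⟪A x, x⟫ = 0) (a c : E3) (hnd : A ≠ 0 ∨ a ≠ 0)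
    (hsym : ∀ x, fderiv ℝ (curl (u t₀)) x (a + A (x - c)) = A (curl (u t₀) x)) :
    ∀ t < 0, ∀ x, u t x = 0 := by
  have hω : Differentiable ℝ (curl (u t₀)) := differentiable_curl_slice hu ht₀
  by_cases hA : A = 0
  · -- TRANSLATION
    have ha : a ≠ 0 := by
      rcases hnd with h | h
      · exact absurd hA h
      · exact h
    subst hA
    have hsym' : ∀ x, fderiv ℝ (curl (u t₀)) x a = 0 := fun x => by simpa using hsym x
    have hper : ∀ x, curl (u t₀) (x + a) = curl (u t₀) x := periodic_of_fderiv_eq_zero hω a hsym'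
    exact InertialMeter.eq_zero_of_vorticityPeriodic_pocket hu ha ht₀ isOpen_univ univ_nonempty fun x _ => hper x
  · obtain ⟨L, α, hα, hconj⟩ := exists_conj_eq_smul_rotGen hskew hA
    set c₁ := c + L.symm (α⁻¹ • rotGen (L a)) with hc₁
    set p := α⁻¹ * (L a) 2 with hp_def
    set v : ℝ → E3 → E3 := fun t y => L (u t (L.symm y + c₁)) with hv_def
    have hv : IsTypeIAncientMild C v :=
      SymmetryModuliCountSymmetricLiouville.isTypeIAncientMild_conj_linearIsometryEquiv
        (isTypeIAncientMild_comp_add hu c₁) L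
    -- the normalised vorticity slice and its transported infinitesimal screw symmetry
    set ψ : E3 → E3 := fun z => L (curl (u t₀) (L.symm z + c₁)) with hψ_def
    set ε : ℝ := (L : E3 →L[ℝ] E3).det with hε
    have hcurlv : ∀ y, curl (v t₀) y = ε • ψ y := fun y => curl_conj_rigidMotion L c₁ (u t₀) y
    have hcv_eq : curl (v t₀) = ε • ψ := funext fun y => by rw [Pi.smul_apply]; exact hcurlv y
    have hψd : Differentiable ℝ ψ := fun y => by
      have h1 : HasFDerivAt (fun z : E3 => L.symm z + c₁)
          (L.symm.toContinuousLinearEquiv : E3 →L[ℝ] E3) y :=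
        L.symm.toContinuousLinearEquiv.hasFDerivAt.add_const c₁
      have h2 := (hω _).hasFDerivAt.comp y h1
      exact (L.toContinuousLinearEquiv.hasFDerivAt.comp y h2).differentiableAt
    have hinfψ : ∀ y, fderiv ℝ ψ y (rotGen y + p • e₃) = rotGen (ψ y) := fun y =>
      fderiv_normalised_screw hω L hα hconj a c hsym y
    have hcvd : Differentiable ℝ (curl (v t₀)) := by rw [hcv_eq]; exact hψd.const_smul ε
    have hinf : ∀ y, fderiv ℝ (curl (v t₀)) y (rotGen y + p • e₃) = rotGen (curl (v t₀) y) := by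
      intro y
      have hD : HasFDerivAt (ε • ψ) (ε • fderiv ℝ ψ y) y := (hψd y).hasFDerivAt.const_smul ε
      rw [hcv_eq, hD.fderiv, smul_apply, hinfψ y, Pi.smul_apply, rotGen_smul]
    have hscrew : ∀ θ y, curl (v t₀) (rotZ θ y + (p * θ) • e₃) = rotZ θ (curl (v t₀) y) :=
      screw_of_fderiv hcvd p hinf
    suffices hzero : ∀ t < 0, ∀ y, v t y = 0 from
      fun t ht x => eq_zero_of_conj_eq_zero L c₁ (hzero t ht) x
    by_cases hp : p = 0
    · -- ROTATION
      have haxiω : ∀ θ y, curl (v t₀) (rotZ θ y) = rotZ θ (curl (v t₀) y) := fun θ y => by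
        simpa [hp] using hscrew θ y
      exact eq_zero_of_isAxisymmetric_all hv (isAxisymmetric_of_curl_slice hv ht₀ haxiω)
    · -- SCREW
      have hP : (p * (2 * Real.pi)) • (e₃ : E3) ≠ 0 :=
        smul_ne_zero (mul_ne_zero hp (by positivity)) (by intro h; simpa [e₃] using congrArg (fun v : E3 => v 2) h)
      have hper : ∀ y, curl (v t₀) (y + (p * (2 * Real.pi)) • e₃) = curl (v t₀) y := fun y => by
        have := hscrew (2 * Real.pi) y
        rwa [SymmetricLiouville.Negative.rotZ_two_pi, SymmetricLiouville.Negative.rotZ_two_pi] at this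
      exact InertialMeter.eq_zero_of_vorticityPeriodic_pocket hv hP ht₀ isOpen_univ univ_nonempty fun y _ => hper y

/-- **Vortex-line pattern Liouville.**  If the VORTEX LINES of ONE slice of `u ∈ A_C` are, on a pocket,
orbits of a nonzero Killing field — `curl u(t₀,x) ∥ a + A(x − c)` on a nonempty open `U` (free amplitude) —
then `u ≡ 0`.  (`lie_eq_of_pattern` for `ω` — analytic and divergence-free — + `liouville_of_vorticitySliceKilling`.) -/
theorem liouville_of_vortexLinePattern (hu : IsTypeIAncientMild C u) {t₀ : ℝ} (ht₀ : t₀ < 0)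
    {A : E3 →L[ℝ] E3} (hskew : ∀ x, ⟪A x, x⟫ = 0) (a c : E3) (hnd : A ≠ 0 ∨ a ≠ 0)
    {U : Set E3} (hU : IsOpen U) (hne : U.Nonempty) {f : E3 → ℝ}
    (hpat : ∀ x ∈ U, curl (u t₀) x = f x • (a + A (x - c))) : ∀ t < 0, ∀ x, u t x = 0 :=
  liouville_of_vorticitySliceKilling hu ht₀ hskew a c hnd
    (lie_eq_of_pattern (analyticOnNhd_curl (hu.analyticOnNhd_slice_univ ht₀))
      (fun x => divergence_curl_eq_zero_holds (u t₀) (InertialMeter.contDiff_two_slice hu ht₀) x)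
      hskew a c hU hne hpat)

end Summit.NavierStokesRegularity.NavierStokesRegularity.Theorems.ScenarioCensus.PatternMeter

end
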